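import Mathlib
import HarnessLib

/-!
# Discrete-coupling degeneracy for Imbrie's chain at γ = 0 — combinatorial core (pub-imbrie, LLA.md §4 M7 / REPAIR-CENSUS N4)

CITATION HEADER (lean-in-tree rule 2026-08-18). Setting: J. Z. Imbrie, *On many-body localization for quantum spin chains*,
J. Stat. Phys. **163** (2016) 998–1048, arXiv:1403.7837 [ImbrieJSP2016], model eq. (1.1) with + boundary conditions. WHAT IS
PROVED: an elementary pigeonhole observation made by the audit cell `pub-imbrie` (NOT a theorem of the paper): at γ = 0 the energy
of a configuration σ ∈ {±1}^n is  E_σ = Σ_i h_i σ_i + Σ_{k=0}^{n} J_k σ_{k-1} σ_k  (σ_{-1} = σ_n = +1); if every coupling is an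
INTEGER of modulus ≤ 1 (e.g. Bernoulli ±1 laws — which are OUTSIDE Imbrie's density hypothesis, p. 1000), then |E_σ| ≤ 2n+1, so E
takes at most 4n+3 values, and for n ≥ 5 (4n+3 < 2^n) two distinct configurations are exactly degenerate
(`exists_degenerate_pair`). Weyl's inequality then keeps two eigenvalues of the γ > 0 Hamiltonian within 2γn of each other, so
the LLA schema (eq. (1.3)) fails for such laws; that analytic half is prose in the cell's LLA.md, not formalised here. Role in the
packet: a witness that the density hypothesis of LLA cannot be dropped — not a refutation of LLA as stated.
Staged from `run/shared/lean/pub/pub-imbrie/lean/seat1/DiscreteDegeneracy.lean` (namespace there `ImbrieLLA.Discrete`; identical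
declarations; authored by seat planner-b2b-imbrie-1-0, re-checked by the referee seats).
-/


namespace Literature.MathematicalPhysics.QuantumLattice.Imbrie2016.Discrete

/-- ±1 spin as an integer. [cite: ImbrieJSP2016, eq. (1.1)] -/
def spin (b : Bool) : ℤ := if b then 1 else -1

/-- a ±1 spin has modulus 1. [folklore] -/
lemma abs_spin_le (b : Bool) : |spin b| ≤ 1 := by
  cases b <;> simp [spin]

/-- Site spin extended by + boundary conditions (sites outside `0 … n-1` are frozen to +1). [cite: ImbrieJSP2016, eq. (1.1)] -/
def ext (n : ℕ) (σ : Fin n → Bool) (i : ℕ) : ℤ :=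
  if hi : i < n then spin (σ ⟨i, hi⟩) else 1

/-- the extended spin has modulus ≤ 1. [folklore] -/
lemma abs_ext_le (n : ℕ) (σ : Fin n → Bool) (i : ℕ) : |ext n σ i| ≤ 1 := by
  unfold ext
  split_ifs <;> simp [abs_spin_le]

/-- γ = 0 energy of the box Hamiltonian with + b.c.; bond `k ∈ {0,…,n}` joins sites `k-1` and `k`
(site `-1` and site `n` frozen to +1). [cite: ImbrieJSP2016, eq. (1.1)] -/
def energy (n : ℕ) (h : Fin n → ℤ) (J : Fin (n + 1) → ℤ) (σ : Fin n → Bool) : ℤ :=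
  (∑ i : Fin n, h i * spin (σ i)) +
    ∑ k : Fin (n + 1), J k * (if k.1 = 0 then 1 else ext n σ (k.1 - 1)) * ext n σ k.1

/-- with couplings of modulus ≤ 1 the γ = 0 energy of an n-site box has modulus ≤ 2n+1. [cite: ImbrieJSP2016, eq. (1.1)] -/
lemma abs_energy_le (n : ℕ) (h : Fin n → ℤ) (J : Fin (n + 1) → ℤ) (σ : Fin n → Bool)
    (hh : ∀ i, |h i| ≤ 1) (hJ : ∀ k, |J k| ≤ 1) :
    |energy n h J σ| ≤ 2 * n + 1 := by
  unfold energy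
  have h1 : |∑ i : Fin n, h i * spin (σ i)| ≤ n := by
    calc |∑ i : Fin n, h i * spin (σ i)|
        ≤ ∑ i : Fin n, |h i * spin (σ i)| := Finset.abs_sum_le_sum_abs _ _
      _ ≤ ∑ _i : Fin n, (1 : ℤ) := by
          apply Finset.sum_le_sum
          intro i _
          rw [abs_mul]
          calc |h i| * |spin (σ i)| ≤ 1 * 1 :=
                mul_le_mul (hh i) (abs_spin_le _) (abs_nonneg _) zero_le_one
            _ = 1 := by ring
      _ = n := by simp
  have h2 : |∑ k : Fin (n + 1), J k * (if k.1 = 0 then 1 else ext n σ (k.1 - 1)) * ext n σ k.1|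
      ≤ n + 1 := by
    calc |∑ k : Fin (n + 1), J k * (if k.1 = 0 then 1 else ext n σ (k.1 - 1)) * ext n σ k.1|
        ≤ ∑ k : Fin (n + 1), |J k * (if k.1 = 0 then 1 else ext n σ (k.1 - 1)) * ext n σ k.1| :=
          Finset.abs_sum_le_sum_abs _ _
      _ ≤ ∑ _k : Fin (n + 1), (1 : ℤ) := by
          apply Finset.sum_le_sum
          intro k _
          have hb : |(if k.1 = 0 then (1 : ℤ) else ext n σ (k.1 - 1))| ≤ 1 := by
            split_ifs <;> simp [abs_ext_le]
          rw [abs_mul, abs_mul]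
          calc |J k| * |(if k.1 = 0 then (1 : ℤ) else ext n σ (k.1 - 1))| * |ext n σ k.1|
              ≤ 1 * 1 * 1 :=
                mul_le_mul (mul_le_mul (hJ k) hb (abs_nonneg _) zero_le_one) (abs_ext_le _ _ _)
                  (abs_nonneg _) (by norm_num)
            _ = 1 := by ring
      _ = n + 1 := by simp
  calc |(∑ i : Fin n, h i * spin (σ i)) +
          ∑ k : Fin (n + 1), J k * (if k.1 = 0 then 1 else ext n σ (k.1 - 1)) * ext n σ k.1|
      ≤ |∑ i : Fin n, h i * spin (σ i)| +
          |∑ k : Fin (n + 1), J k * (if k.1 = 0 then 1 else ext n σ (k.1 - 1)) * ext n σ k.1| :=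
        abs_add_le _ _
    _ ≤ n + (n + 1) := add_le_add h1 h2
    _ = 2 * n + 1 := by ring

/-- `4n+3 < 2^n` for `n ≥ 5`. [folklore] -/
lemma four_mul_add_three_lt_two_pow (n : ℕ) (hn : 5 ≤ n) : 4 * n + 3 < 2 ^ n := by
  induction n, hn using Nat.le_induction with
  | base => norm_num
  | succ m hm ih =>
    have h4 : 4 ≤ 2 ^ m := by
      calc 4 = 2 ^ 2 := by norm_num
        _ ≤ 2 ^ m := Nat.pow_le_pow_right (by norm_num) (by omega)
    calc 4 * (m + 1) + 3 = (4 * m + 3) + 4 := by ring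
      _ < 2 ^ m + 2 ^ m := by omega
      _ = 2 ^ (m + 1) := by ring

/-- **Combinatorial core of LLA.md §4 M7.** With integer couplings of modulus ≤ 1 (Bernoulli ±1 laws),
every box of `n ≥ 5` sites has two distinct spin configurations with equal γ = 0 energy. [cite: ImbrieJSP2016, eq. (1.1)] -/
theorem exists_degenerate_pair (n : ℕ) (hn : 5 ≤ n) (h : Fin n → ℤ) (J : Fin (n + 1) → ℤ)
    (hh : ∀ i, |h i| ≤ 1) (hJ : ∀ k, |J k| ≤ 1) :
    ∃ σ τ : Fin n → Bool, σ ≠ τ ∧ energy n h J σ = energy n h J τ := by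
  classical
  set S : Finset ℤ := Finset.Icc (-(2 * (n : ℤ) + 1)) (2 * n + 1) with hSdef
  have hmem : ∀ σ : Fin n → Bool, energy n h J σ ∈ S := by
    intro σ
    have hb := abs_energy_le n h J σ hh hJ
    rw [abs_le] at hb
    rw [hSdef, Finset.mem_Icc]
    constructor <;> linarith [hb.1, hb.2]
  let f : (Fin n → Bool) → S := fun σ => ⟨energy n h J σ, hmem σ⟩
  have hS : Fintype.card S = 4 * n + 3 := by
    have hlen : (2 * (n : ℤ) + 1 + 1 - -(2 * (n : ℤ) + 1)) = ((4 * n + 3 : ℕ) : ℤ) := by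
      push_cast; ring
    rw [Fintype.card_coe, hSdef, Int.card_Icc, hlen, Int.toNat_natCast]
  have hcard : Fintype.card S < Fintype.card (Fin n → Bool) := by
    rw [hS, Fintype.card_fun, Fintype.card_bool, Fintype.card_fin]
    exact four_mul_add_three_lt_two_pow n hn
  obtain ⟨σ, τ, hne, hEq⟩ := Fintype.exists_ne_map_eq_of_card_lt f hcard
  exact ⟨σ, τ, hne, by simpa [f] using congrArg Subtype.val hEq⟩

end Literature.MathematicalPhysics.QuantumLattice.Imbrie2016.Discrete
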